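import Summits.BirchSwinnertonDyer.Rank1Residual.X11b.BDPRouteOpenInputFieldSupply
import HarnessLib

/-!
# Class X11b, route p2 at `p ≥ 5`: THE OPEN STATEMENT AT ITS WEAKEST IN THE DATUM DIRECTION (III)
# — in PRINT CURRENCY: (2.4)∃♭ and value∃♭ over ONE admissible field give the composite input over
# that field, hence the Locus / semistable records; and (2.4)∃♭ over the Hoffstein–Luo fields with
# prescribed split primes suffices (cell `b2b-bsdres`, sub-cell `multr1-p2`, gen 27; file 3 of 3)

HONEST FRAMING (cell `b2b-bsdres`, run/shared/lean/b2b/bsd-rank1-residual/, verbatim in every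
file): the goal of the cell is to DELETE the COMBINATION-SHAPED residual classes of the
Birch–Swinnerton-Dyer formula for ALL analytic-rank `≤ 1` elliptic curves over `ℚ` — "full BSD
formula for every rank `≤ 1` curve in class `C`" assembled STRICTLY from published theorems — so
that the rank-`≤ 1` remainder becomes exactly the CONSTRUCTION-SHAPED classes, which are TYPED
(missing-input `Prop`s), NOT attempted. This is not "finishing BSD". Sub-cell `multr1-p2` is a
RESEARCH ROUTE on class X11b (`ClassX11b W p := r_an = 1 ∧ p ≠ 2 ∧ mult(p) ∧ irr(p)`); no claim
beyond the stated class and loci; X11b's label does not change; NOTHING is booked by this file.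

THEOREMS plus TWO per-field shape definitions — the bodies of gen 25's class-wide
`P2.IMCDivSomeFrameOnTree` ((2.4)∃♭, OPEN; conjecture-tagged since gen 29, claim-tagged in gens 27–28,
see SCOPE below) and `P2.BDPValueSomeFrameOnTree` (value∃♭, PUB shape) VERBATIM with the field `K` a
PARAMETER; OPEN / PUB-shaped exactly as their parents; nothing asserted.

SCOPE OF THE ANNOUNCED DERIVATION (gen 29, doc + tag only; statements byte-identical; sources re-read
verbatim). `P2.IMCDivSomeFrameOnTreeAtField W p K` — THE typed open statement of route p2 off
`R1Population` ((T1″) of the cell's records) — is asked at CLASSICAL Heegner data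
(`SatisfiesHeegnerHypothesis`: every `ℓ ∣ N_E` split in `K`). The derivation its gen-27 docstring
pointed at, the erratum's "(2.4) … By [FW21, Thm. 4.41]", carries Fouquet–Wan's hypothesis "there
exists `q ∥ N` (in particular `q ∤ p`) which is not split in `K`" (arXiv:2107.13726v3, Thm. 4.41, third
hypothesis; the full inclusion moreover wants every non-split `ℓ ∣ N` RAMIFIED in `K`, `π(f)_ℓ` special
Steinberg twisted by the unramified quadratic character), exactly as [Castella2018, p. 4] ("at least
one prime `q ∣ N` nonsplit in `K`") and [Castella2024, Thm. 3.1 (iii)] do; classical Heegner data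
EXCLUDE such a `q`. So that derivation lives at route R1's ERRATUM fields and is typed there
(`P2.IMCDivIntFrameAtErratumData`, `X11b/BDPRouteErratumData.lean`, gen 28: (T1-err), covering
`R1Population`); at classical Heegner fields the published result in this direction is
[BurungaleCastellaSkinner2025, Thm. 1.2.4] (`ch(X_Gr) = (L_p^BDP)`, primes `p > 3` of GOOD ORDINARY
reduction), whose multiplicative analogue (`p ∥ N`, this shape) is in no source the cell holds, and
the only printed statement in this direction at `p ∥ N` is STEP L itself ([SkinnerZhang2014] Thm. 1.2,
PREPRINT; `indexLowerBoundAt_of_skinnerZhang_OPEN`). Hence: NO announced derivation at these data; the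
shape (an instance of the Iwasawa–Greenberg main conjecture for `X_ac(E[p^∞])`, [Castella2018, §1
(1.b)]) is re-badged `@[conjecture]`; every record using it stays CONDITIONAL; nothing else changes.

## What this file proves

* `P2.IMCDivSomeFrameOnTreeAtField W p K`, `P2.BDPValueSomeFrameOnTreeAtField W p K`; restriction
  from the class-wide shapes; `P2.IMCDivSomeFrameOnTree W p ↔ ∀ K, …AtField W p K`;
  `P2.bdpValueSomeFrameOnTreeAtField_of_thm32_of_semistable` (value over `K` from `h32` = Castella
  2018 Thms. 3.1–3.2 on semistable pairs).
* **`P2.openInputOnTreeAtField_of_someFrames`**: (2.4)∃♭ ∧ value∃♭ over `K` ⟹ the composite open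
  input over `K` (the pointwise argument of gens 24–25 UNCHANGED, run over one field: ♭-V1RIG moves
  the value to the (2.4)-frame; `rank E(K) = 1`; THE embedding; the two primes above `p`).
* Records: **`P2.bsdp_of_locus_of_someFramesAtField`** (ANY Locus pair: facts + (2.4)∃♭ and
  value∃♭ over ONE admissible field), **`P2.bsdp_of_semistable_locus_of_imcDivSomeFrameAtField`**
  (semistable Locus pair, 723 144 ‖ 28 657: facts + `h32` + (2.4)∃♭ over ONE admissible field —
  THE open statement asked at one field, nothing else typed), and
  **`P2.bsdp_of_semistable_locus_of_imcDivSomeFrame_prescribedFields`** (the same with (2.4)∃♭ asked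
  over the Hoffstein–Luo fields with any prescribed finite set of split primes, `d_K ≡ 1 (mod 8)`,
  `|d_K| > B`).

Reading for the registry: the attach point of route p2 for a refereed anticyclotomic main conjecture
at `p ∥ N` is "(2.4) for SOME frame at the p2-data over SOME admissible Heegner field" — or over all
admissible fields with any prescribed finite set of split primes, `2` split and `|d_K|` large —; with
gen 26 (frame- and receptacle-free) the statement sees neither the frame, nor the receptacle, nor which
admissible field. CONDITIONAL on (2.4)∃♭ (OPEN; no announced derivation at classical data, SCOPE
above); nothing booked; labels UNCHANGED; X11b stays CONSTRUCTION-SHAPED.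

## References

* [Castella2018] §1 (1.b) (p. 3), p. 4, Thm. 2.3, Thms. 3.1–3.2, §5 (arXiv:1704.06608 pp. 5, 9, 12).
* [Castella2018Erratum] (2.4), Thm. 1.1 (pp. 1, 4). * [Hsieh2014] Thm. 1, p. 7 (arXiv:1112.1580).
* [FouquetWan2021] Thm. 4.41 (arXiv:2107.13726v3 p. 44; PREPRINT). * [Castella2024] Thm. 3.1 (PREPRINT).
* [BurungaleCastellaSkinner2025] Thm. 1.2.4. * [SkinnerZhang2014] Thm. 1.2 (PREPRINT).
* [HoffsteinLuo1997] Theorem. * [Skinner2016PacificMC] Thm. C (§1).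
-/

noncomputable section

open scoped Classical NumberField

open WeierstrassCurve NumberField IsDedekindDomain Field PowerSeries
open Literature.NumberTheory.EllipticCurves Literature.NumberTheory.EllipticCurves.GreenbergSelmer
  Literature.NumberTheory.EllipticCurves.ModularForms
  Literature.NumberTheory.EllipticCurves.Rank1Residual
  Literature.NumberTheory.EllipticCurves.Rank1Residual.Typed
  Literature.NumberTheory.EllipticCurves.Wuthrich2014
  Literature.NumberTheory.EllipticCurves.Castella2018
  Literature.NumberTheory.EllipticCurves.BalakrishnanEtAl2019
  Literature.NumberTheory.QuadraticFields.Quadratic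
  Literature.NumberTheory.Automorphic
  Literature.NumberTheory.GaloisRepresentations Literature.NumberTheory.GaloisCohomology
  Summit.BirchSwinnertonDyer.Rank1Residual.X11b.AcSelmer
  Summit.BirchSwinnertonDyer.Rank1Residual.X11b.LocBridge
  Summit.BirchSwinnertonDyer.Rank1Residual.X11b.CongruenceLimit
  Summit.BirchSwinnertonDyer.Rank1Residual.X11b.Halves

namespace Summit.BirchSwinnertonDyer.Rank1Residual.X11b

/-! ### §5 One level up, in print currency: (2.4)∃♭ and value∃♭ over ONE field -/

section PrintCurrency

variable (W : WeierstrassCurve ℚ) [W.IsElliptic] [W.IsGloballyMinimal] (p : ℕ) [Fact p.Prime]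
  (K : Type) [Field K] [NumberField K]

/-- **(2.4)∃♭ OVER THE FIELD `K`** — the body of `P2.IMCDivSomeFrameOnTree W p` (gen 25: at every
p2-datum, for every `ι'`, `w₀`, `P'`, `e` inducing `𝔭_{ι'}`, THERE IS a ♭-frame
`(Ω_K ≠ 0, ‖Ω_p‖ = 1, Q ∈ 𝓞_{ℂ_p}⟦T⟧)` with Castella's interpolation property and
`Ch_Λ(X_ac^∅(E[p^∞]))·𝓞_{ℂ_p}⟦T⟧ ⊆ (Q)`) VERBATIM, with the field `K` a PARAMETER: THE open statement
of route p2 asked over `K` only. `P2.IMCDivSomeFrameOnTree W p ↔ ∀ K, P2.IMCDivSomeFrameOnTreeAtField W p K`.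
OPEN exactly as its parent, with NO announced derivation at these classical data (file docstring,
SCOPE, gen 29: the erratum's "(2.4) ⇐ [FW21, Thm. 4.41]" needs a prime `q ∥ N` NOT split in `K`; the
announced derivation is typed at erratum data as `P2.IMCDivIntFrameAtErratumData`); an instance of the
Iwasawa–Greenberg main conjecture for `X_ac(E[p^∞])` (one inclusion) at `p ∥ N` over the classical
Heegner field `K` — the multiplicative analogue of [BurungaleCastellaSkinner2025, Thm. 1.2.4] (good
ordinary `p`), not in print; a predicate, NEVER a theorem here. (Gens 27–28 badged it as
claimed-by-the-erratum — withdrawn gen 29: the erratum does not state (2.4) at these data.)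
[cite: Castella2018, §1 (1.b) (arXiv:1704.06608 p. 3) and Thm. 3.1, display (3.2) (p. 9) (conjecture display and frame; shape only; nothing asserted)]
[cite: Castella2018Erratum, (2.4) (p. 4) (display transcribed; its derivation there assumes a prime of N non-split in K; nothing asserted)]
[cite: Hsieh2014, p. 7 (arXiv:1112.1580) (the receptacle `Z̄_p⟦Γ⁻⟧ ⊆ 𝓞_{ℂ_p}⟦T⟧`)] -/
@[conjecture]
def P2.IMCDivSomeFrameOnTreeAtField : Prop :=
  ∀ (N : ℕ) [NeZero N] (Dt : ModularParametrizationData W N) (H : HeegnerDatum N (NumberField.discr K))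
    (ι : K →+* ℂ) (P : (W.baseChange K).toAffine.Point),
    ClassX11b W p → 5 ≤ p → Surj W p → W.conductorNorm ℤ = N → IsImaginaryQuadratic K →
    Odd (NumberField.discr K) → ¬ (p : ℤ) ∣ NumberField.discr K → ¬ p ∣ Units.torsionOrder K →
    SatisfiesHeegnerHypothesis N K →
    (W.quadraticTwist (NumberField.discr K : ℚ)).entireLFunction 1 ≠ 0 →
    WeierstrassCurve.Affine.Point.map ι.toRatAlgHom P = heegnerPointComplex Dt H →
    ¬ (p : ℤ) ∣ Dt.c → ¬ IsOfFinAddOrder P →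
    ∀ (κ : ZpExtension K p), κ.IsAnticyclotomic →
      ∀ (γ : Field.absoluteGaloisGroup K) [Fact (κ.IsTopGenerator γ)]
        (ι' : PadicAlgCl p ≃+* ℂ) (w₀ : InfinitePlace K) (P' : (W.baseChange K).toAffine.Point),
        WeierstrassCurve.Affine.Point.map w₀.embedding.toRatAlgHom P' = heegnerPointComplex Dt H →
        ∀ (e : K →+* ℚ_[p]),
          (∀ k : 𝓞 K, k ∈ (primeOfEmbeddingDatum p ι' w₀.embedding).asIdeal ↔ ‖e (k : K)‖ < 1) →
          ∃ (ΩK : ℂ) (Ωp : ℂ_[p]) (Q : PowerSeries 𝓞_ℂ_[p]), ΩK ≠ 0 ∧ ‖Ωp‖ = 1 ∧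
            R1.IsBDPLFunctionInt p ι' (primeOfEmbeddingDatum p ι' w₀.embedding) κ γ Dt.f ΩK Ωp Q ∧
            (XAc.charIdeal (W.baseChange K) p κ (primeOfEmbeddingDatum p ι' w₀.embedding) ∅ γ).map
              (PowerSeries.map (R1.toCpInt p)) ≤ Ideal.span {Q}

/-- **value∃♭ OVER THE FIELD `K`** — the body of `P2.BDPValueSomeFrameOnTree W p` (gen 25: at every
p2-datum THERE IS a ♭-frame with Castella's interpolation property and the BDP value
`Q(𝟙) = u·((1 − a_p(E) p⁻¹)·log_{ω_E} P')²`, `‖u‖ = 1`) VERBATIM, with the field `K` a PARAMETER.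
PUB shape (Cas18 Thms. 3.1–3.2: PUBLISHED on semistable pairs via `h32`,
`P2.bdpValueSomeFrameOnTreeAtField_of_thm32_of_semistable`; at non-semistable split `p ≥ 5` printed in
[cas-split] Thm. 2.11 in continuous-function currency; PREPRINT elsewhere). A predicate; nothing asserted.
[cite: Castella2018, Thm. 3.1 and Thm. 3.2 (arXiv:1704.06608 p. 9) (shape only; nothing asserted)] -/
def P2.BDPValueSomeFrameOnTreeAtField : Prop :=
  ∀ (N : ℕ) [NeZero N] (Dt : ModularParametrizationData W N) (H : HeegnerDatum N (NumberField.discr K))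
    (ι : K →+* ℂ) (P : (W.baseChange K).toAffine.Point),
    ClassX11b W p → 5 ≤ p → Surj W p → W.conductorNorm ℤ = N → IsImaginaryQuadratic K →
    Odd (NumberField.discr K) → ¬ (p : ℤ) ∣ NumberField.discr K → ¬ p ∣ Units.torsionOrder K →
    SatisfiesHeegnerHypothesis N K →
    (W.quadraticTwist (NumberField.discr K : ℚ)).entireLFunction 1 ≠ 0 →
    WeierstrassCurve.Affine.Point.map ι.toRatAlgHom P = heegnerPointComplex Dt H →
    ¬ (p : ℤ) ∣ Dt.c → ¬ IsOfFinAddOrder P →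
    ∀ (κ : ZpExtension K p), κ.IsAnticyclotomic →
      ∀ (γ : Field.absoluteGaloisGroup K) [Fact (κ.IsTopGenerator γ)]
        (ι' : PadicAlgCl p ≃+* ℂ) (w₀ : InfinitePlace K) (P' : (W.baseChange K).toAffine.Point),
        WeierstrassCurve.Affine.Point.map w₀.embedding.toRatAlgHom P' = heegnerPointComplex Dt H →
        ∀ (e : K →+* ℚ_[p]),
          (∀ k : 𝓞 K, k ∈ (primeOfEmbeddingDatum p ι' w₀.embedding).asIdeal ↔ ‖e (k : K)‖ < 1) →
          ∃ (ΩK : ℂ) (Ωp : ℂ_[p]) (Q : PowerSeries 𝓞_ℂ_[p]), ΩK ≠ 0 ∧ ‖Ωp‖ = 1 ∧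
            R1.IsBDPLFunctionInt p ι' (primeOfEmbeddingDatum p ι' w₀.embedding) κ γ Dt.f ΩK Ωp Q ∧
            R1.BDPValueAtOneIntAt W p e P' Q (W.LFunction p)

variable {W p K}

omit [W.IsElliptic] [W.IsGloballyMinimal] in
/-- Class-wide (2.4)∃♭ ⟹ (2.4)∃♭ over `K`. [claim: Castella2018Erratum, status: under-review] -/
theorem P2.imcDivSomeFrameOnTreeAtField_of_imcDivSomeFrameOnTree (hD : P2.IMCDivSomeFrameOnTree W p) :
    P2.IMCDivSomeFrameOnTreeAtField W p K :=
  fun N _ Dt H ι P ↦ hD N K Dt H ι P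

omit [W.IsElliptic] [W.IsGloballyMinimal] in
variable (W p) in
/-- **Class-wide (2.4)∃♭ ⟺ (2.4)∃♭ over every field** (binder bookkeeping only).
[claim: Castella2018Erratum, status: under-review] -/
theorem P2.imcDivSomeFrameOnTree_iff_forall_field :
    P2.IMCDivSomeFrameOnTree W p ↔
      ∀ (K : Type) [Field K] [NumberField K], P2.IMCDivSomeFrameOnTreeAtField W p K :=
  ⟨fun hD _ _ _ ↦ P2.imcDivSomeFrameOnTreeAtField_of_imcDivSomeFrameOnTree hD,
    fun h N _ K _ _ Dt H ι P ↦ h K N Dt H ι P⟩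

/-- Class-wide value∃♭ ⟹ value∃♭ over `K`. [cite: Castella2018, Thms. 3.1–3.2 (arXiv:1704.06608 p. 9)] -/
theorem P2.bdpValueSomeFrameOnTreeAtField_of_bdpValueSomeFrameOnTree
    (hV : P2.BDPValueSomeFrameOnTree W p) : P2.BDPValueSomeFrameOnTreeAtField W p K :=
  fun N _ Dt H ι P ↦ hV N K Dt H ι P

/-- **value∃♭ over `K` on a SEMISTABLE pair from the published fact `h32`** (Castella 2018 Thms.
3.1–3.2; gen 25's class-wide `P2.bdpValueSomeFrameOnTree_of_thm32_of_semistable`, restricted).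
[cite: Castella2018, Thm. 3.1, display (3.2) and Thm. 3.2 (arXiv:1704.06608 p. 9)] -/
theorem P2.bdpValueSomeFrameOnTreeAtField_of_thm32_of_semistable
    (h32 : thm32_exists_isBDPLFunction_valueAtOne) (hss : Semistable W) :
    P2.BDPValueSomeFrameOnTreeAtField W p K :=
  P2.bdpValueSomeFrameOnTreeAtField_of_bdpValueSomeFrameOnTree
    (P2.bdpValueSomeFrameOnTree_of_thm32_of_semistable h32 hss)

/-- **(2.4)∃♭ ∧ value∃♭ OVER `K` ⟹ THE COMPOSITE OPEN INPUT OVER `K`**, given `hnf` (modularity),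
`hGZK` and the one-sided control `P2ControlUpperOnTreeAt W p` (a tree theorem on every pair since gen
17, `p2ControlUpperOnTreeAt_of_facts`). The pointwise argument of gens 24–25 UNCHANGED, run over the
one field `K`: the two ♭-frames at a datum have the same constant term up to norm (♭-V1RIG,
`R1.bdpValueAtOneIntAt_of_frames`), so the (2.4)-frame carries the value; `rank E(K) = 1`
(Gross–Zagier–Kolyvagin) makes `log_{ω_E}` of the Galois-conjugate Heegner point agree; THE embedding
at `𝔭` induces `𝔭`; each degree-one `𝔭 ∋ p` is `𝔭_{ι₀}` or `𝔭_{ι₀ ∘ conj}`; then x11b3's pointwise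
assembly `R1.imcLowerWaldspurgerOnTreeAt_of_intValue_of_intDvd`. CONDITIONAL on the two shapes over
`K`. [cite: Castella2018, Thms. 2.3, 3.1, 3.2, §5 (arXiv:1704.06608 pp. 5, 9, 12)]
[cite: Castella2018Erratum, (2.4) (p. 4)] -/
theorem P2.openInputOnTreeAtField_of_someFrames_of_controlUpper (hnf : exists_isNewformOf)
    (hGZK : rank_eq_analyticRank_of_analyticRank_le_one) (hC : P2ControlUpperOnTreeAt W p)
    (ι₀ : PadicAlgCl p ≃+* ℂ) (hD : P2.IMCDivSomeFrameOnTreeAtField W p K)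
    (hV : P2.BDPValueSomeFrameOnTreeAtField W p K) : P2.OpenInputOnTreeAtField W p K := by
  intro N _ Dt H ιK P hX h5 hs hN hK hodd hpd hμ hHN hLt hP hc hPinf κ hκ γ hγ 𝔭 h𝔭 he hf
  obtain ⟨n, hn, -⟩ := hC N K Dt H ιK P hX h5 hs hN hK hodd hpd hμ hHN hLt hP hc hPinf κ hκ γ 𝔭 h𝔭 he hf
  have hD' := hD N Dt H ιK P hX h5 hs hN hK hodd hpd hμ hHN hLt hP hc hPinf κ hκ γ
  have hV' := hV N Dt H ιK P hX h5 hs hN hK hodd hpd hμ hHN hLt hP hc hPinf κ hκ γ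
  subst hN
  obtain ⟨hr, -, -, -⟩ := hX
  obtain ⟨w₀⟩ := (inferInstance : Nonempty (InfinitePlace K))
  have hp2 : p ≠ 2 := by omega
  -- `rank_ℤ E(K) = 1` (Gross–Zagier–Kolyvagin)
  have hrk : (W.baseChange K).mordellWeilRank = 1 :=
    mordellWeilRank_baseChange_eq_one_of_twist_ne_zero W hGZK hnf hr hK.1 hLt
  -- the datum's complex embedding is `w₀.embedding ∘ τ` for some `τ ∈ Gal(K/ℚ)`, `τ² = 1`
  haveI : IsGalois ℚ K := by
    haveI : Algebra.IsQuadraticExtension ℚ K := ⟨hK.1⟩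
    infer_instance
  obtain ⟨σ, hσ⟩ := ComplexEmbedding.exists_comp_symm_eq_of_comp_eq (k := ℚ) w₀.embedding ιK
    (by ext x; simp)
  set τ : K →+* K := ((σ.symm : K ≃ₐ[ℚ] K) : K →+* K) with hτdef
  have hτ : ∀ x, τ (τ x) = x := by
    intro x
    have hcard : Nat.card (K ≃ₐ[ℚ] K) = 2 := by rw [IsGalois.card_aut_eq_finrank, hK.1]
    have hsq : σ.symm * σ.symm = 1 := by
      have h := pow_card_eq_one' (G := K ≃ₐ[ℚ] K) (x := σ.symm)
      rwa [hcard, pow_two] at h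
    have := congrArg (fun g : K ≃ₐ[ℚ] K ↦ g x) hsq
    simpa [hτdef, AlgEquiv.mul_apply] using this
  -- the Galois conjugate `P' = τ_* P` is the Heegner point read through `w₀.embedding`
  set P' := WeierstrassCurve.Affine.Point.map τ.toRatAlgHom P with hP'def
  have hP' : WeierstrassCurve.Affine.Point.map w₀.embedding.toRatAlgHom P' =
      heegnerPointComplex Dt H := by
    rw [hP'def, WeierstrassCurve.Affine.Point.map_map]
    have hcomp : w₀.embedding.toRatAlgHom.comp τ.toRatAlgHom = ιK.toRatAlgHom := by
      apply AlgHom.ext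
      intro x
      have := RingHom.congr_fun hσ x
      simpa [hτdef] using this
    rw [hcomp]
    exact hP
  have hlog : ∀ e : K →+* ℚ_[p], padicLogOrd W p e P' = padicLogOrd W p e P := fun e ↦
    R1.padicLogOrd_map_eq_of_rank_one W p e P hp2 τ hτ hrk hPinf
  -- THE embedding at `𝔭` induces `𝔭`
  have hemb : ∀ k : 𝓞 K, k ∈ 𝔭.asIdeal ↔ ‖embAt K p 𝔭 h𝔭 he hf (k : K)‖ < 1 :=
    mem_asIdeal_iff_norm_embAt_lt_one 𝔭 h𝔭 he hf
  -- every degree-one prime above `p` is induced by `ι₀` or by `ι₀ ∘ conj`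
  have key : ∀ ι' : PadicAlgCl p ≃+* ℂ, 𝔭 = primeOfEmbeddingDatum p ι' w₀.embedding →
      IMCLowerWaldspurgerOnTreeAt p κ 𝔭 γ (embAt K p 𝔭 h𝔭 he hf) P := by
    intro ι' h𝔭eq
    subst h𝔭eq
    obtain ⟨ΩK, Ωp, Q, hΩK, hΩp, hQ, hdiv⟩ := hD' ι' w₀ P' hP' (embAt K p _ h𝔭 he hf) hemb
    obtain ⟨ΩK', Ωp', Q', hΩK', hΩp', hQ', hval⟩ := hV' ι' w₀ P' hP' (embAt K p _ h𝔭 he hf) hemb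
    have hΩp0 : Ωp ≠ 0 := fun h ↦ by rw [h, norm_zero] at hΩp; exact zero_ne_one hΩp
    have hΩp0' : Ωp' ≠ 0 := fun h ↦ by rw [h, norm_zero] at hΩp'; exact zero_ne_one hΩp'
    -- the (2.4)-frame carries the value (♭-V1RIG)
    obtain ⟨u, hu1, hu⟩ :=
      R1.bdpValueAtOneIntAt_of_frames hp2 hK hκ hγ.out hΩK hΩK' hΩp0 hΩp0' hQ hQ' hval
    refine imcLowerWaldspurgerOnTreeAt_of_padicLogOrd_eq W p _ (hlog _) ?_
    exact R1.imcLowerWaldspurgerOnTreeAt_of_intValue_of_intDvd hn hdiv hu1.le (W.LFunction p) hu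
  rcases eq_primeOfEmbeddingDatum_or_eq_trans_starRingAut p ι₀ hK w₀ h𝔭 with h | h
  · exact key ι₀ h
  · exact key _ h

/-- **(2.4)∃♭ ∧ value∃♭ over `K` ⟹ the composite open input over `K`, from the facts** (`hnf`,
`hGZK`, Kolyvagin, the CITED Poitou–Tate and local Euler characteristic through
`p2ControlUpperOnTreeAt_of_facts`). [cite: Castella2018, Thms. 2.3, 3.1, 3.2, §5 (arXiv:1704.06608 pp. 5, 9, 12)]
[cite: Castella2018Erratum, (2.4) (p. 4)] [cite: MilneADT2006, Ch. I, Thm. 4.10(b) and Thm. 2.8] -/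
theorem P2.openInputOnTreeAtField_of_someFrames (hnf : exists_isNewformOf)
    (hGZK : rank_eq_analyticRank_of_analyticRank_le_one)
    (hKo : ∀ (N : ℕ) [NeZero N] (W : WeierstrassCurve ℚ) (K : Type) [Field K] [NumberField K],
      kolyvagin N W K)
    (hPT : ∀ (K : Type) [Field K] [NumberField K], poitouTate_sum_localTatePairing_eq_zero K)
    (hEP : ∀ (K : Type) [Field K] [NumberField K] (v : HeightOneSpectrum (𝓞 K)),
      localEulerPoincareCharacteristic (v.adicCompletion K))
    (hD : P2.IMCDivSomeFrameOnTreeAtField W p K) (hV : P2.BDPValueSomeFrameOnTreeAtField W p K) :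
    P2.OpenInputOnTreeAtField W p K := by
  obtain ⟨ι₀⟩ := PadicAlgCl.nonempty_ringEquiv_complex p
  exact P2.openInputOnTreeAtField_of_someFrames_of_controlUpper hnf hGZK
    (p2ControlUpperOnTreeAt_of_facts W p hKo hPT hEP) ι₀ hD hV

/-- **A1 — ANY Locus pair (semistable or not): `BSD(E,p)` from published + cited facts, (2.4)∃♭
and value∃♭ over ONE admissible field — nothing per pair, nothing at any other field.**
CONDITIONAL on the two shapes over `K` ((2.4): OPEN; value: PUB shape); nothing booked.
[cite: Castella2018Erratum, (2.4), Thm. 1.1 (pp. 1, 4)] [cite: Castella2018, Thms. 3.1–3.2, §5]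
[cite: Skinner2016PacificMC, Thm. C (§1)] [cite: McCallumLMS1991, §1 Theorem (Kolyvagin), p. 296] -/
theorem P2.bsdp_of_locus_of_someFramesAtField
    (hGZ : ∀ (N : ℕ) [NeZero N] (W : WeierstrassCurve ℚ) (K : Type) [Field K] [NumberField K],
      gross_zagier N W K)
    (hKo : ∀ (N : ℕ) [NeZero N] (W : WeierstrassCurve ℚ) (K : Type) [Field K] [NumberField K],
      kolyvagin N W K)
    (hB : ∀ (N : ℕ) [NeZero N] (W : WeierstrassCurve ℚ) (K : Type) [Field K] [NumberField K],
      Kolyvagin1990_padicValNat_card_sha_le N W K)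
    (hSk : Skinner2016.thmC_padicValRat_bsd_rank_zero) (hWu : sha_dvd_analyticSha)
    (hGZK : rank_eq_analyticRank_of_analyticRank_le_one) (hnf : exists_isNewformOf)
    (hHL : HoffsteinLuo1997_exists_twist_L_one_ne_zero) (hMaz : mazur_not_dvd_maninConstant_of_odd)
    (hPT : ∀ (K : Type) [Field K] [NumberField K], poitouTate_sum_localTatePairing_eq_zero K)
    (hEP : ∀ (K : Type) [Field K] [NumberField K] (v : HeightOneSpectrum (𝓞 K)),
      localEulerPoincareCharacteristic (v.adicCompletion K))
    -- ONE admissible field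
    (hK : IsImaginaryQuadratic K) (hodd : Odd (NumberField.discr K))
    (hpd : ¬ (p : ℤ) ∣ NumberField.discr K) (hμ : ¬ p ∣ Units.torsionOrder K)
    (hHN : SatisfiesHeegnerHypothesis (W.conductorNorm ℤ) K)
    (hLt : (W.quadraticTwist (NumberField.discr K : ℚ)).entireLFunction 1 ≠ 0)
    -- THE open statement and the value shape, over `K`
    (hD : P2.IMCDivSomeFrameOnTreeAtField W p K) (hV : P2.BDPValueSomeFrameOnTreeAtField W p K)
    -- the pair: on the Locus
    (hX : ClassX11b W p) (hp5 : 5 ≤ p) (hram : Ram W p) (htam : ¬ p ∣ W.tamagawaProduct) :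
    BSDp W p :=
  P2.bsdp_of_locus_of_openInputAtField W p hGZ hKo hB hSk hWu hGZK
    (hasEntireLFunction_rat_of_exists_isNewformOf hnf) hnf hHL hMaz hPT hEP hK hodd hpd hμ hHN hLt
    (P2.openInputOnTreeAtField_of_someFrames hnf hGZK hKo hPT hEP hD hV) hX hp5 hram htam

/-- **A1 ∩ semistable — ANY semistable Locus pair (723 144 ‖ 28 657): `BSD(E,p)` from published +
cited facts (incl. `h32`, Castella 2018 Thms. 3.1–3.2) and (2.4)∃♭ over ONE admissible field — THE
open statement asked at ONE field, nothing else typed.** Gen 25's `P2.bsdp_of_locus_of_imcDivSomeFrame_of_semistable`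
asked (2.4)∃♭ at every field. CONDITIONAL on (2.4)∃♭ over `K`; nothing booked.
[cite: Castella2018Erratum, (2.4), Thm. 1.1 (pp. 1, 4)] [cite: Castella2018, Thms. 3.1–3.2, §5]
[cite: Skinner2016PacificMC, Thm. C (§1)] [cite: McCallumLMS1991, §1 Theorem (Kolyvagin), p. 296] -/
theorem P2.bsdp_of_semistable_locus_of_imcDivSomeFrameAtField
    (hGZ : ∀ (N : ℕ) [NeZero N] (W : WeierstrassCurve ℚ) (K : Type) [Field K] [NumberField K],
      gross_zagier N W K)
    (hKo : ∀ (N : ℕ) [NeZero N] (W : WeierstrassCurve ℚ) (K : Type) [Field K] [NumberField K],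
      kolyvagin N W K)
    (hB : ∀ (N : ℕ) [NeZero N] (W : WeierstrassCurve ℚ) (K : Type) [Field K] [NumberField K],
      Kolyvagin1990_padicValNat_card_sha_le N W K)
    (hSk : Skinner2016.thmC_padicValRat_bsd_rank_zero) (hWu : sha_dvd_analyticSha)
    (hGZK : rank_eq_analyticRank_of_analyticRank_le_one) (hnf : exists_isNewformOf)
    (hHL : HoffsteinLuo1997_exists_twist_L_one_ne_zero) (hMaz : mazur_not_dvd_maninConstant_of_odd)
    (hPT : ∀ (K : Type) [Field K] [NumberField K], poitouTate_sum_localTatePairing_eq_zero K)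
    (hEP : ∀ (K : Type) [Field K] [NumberField K] (v : HeightOneSpectrum (𝓞 K)),
      localEulerPoincareCharacteristic (v.adicCompletion K))
    (h32 : thm32_exists_isBDPLFunction_valueAtOne) (hss : Semistable W)
    -- ONE admissible field
    (hK : IsImaginaryQuadratic K) (hodd : Odd (NumberField.discr K))
    (hpd : ¬ (p : ℤ) ∣ NumberField.discr K) (hμ : ¬ p ∣ Units.torsionOrder K)
    (hHN : SatisfiesHeegnerHypothesis (W.conductorNorm ℤ) K)
    (hLt : (W.quadraticTwist (NumberField.discr K : ℚ)).entireLFunction 1 ≠ 0)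
    -- THE open statement, over `K`
    (hD : P2.IMCDivSomeFrameOnTreeAtField W p K)
    -- the pair: on the Locus
    (hX : ClassX11b W p) (hp5 : 5 ≤ p) (hram : Ram W p) (htam : ¬ p ∣ W.tamagawaProduct) :
    BSDp W p :=
  P2.bsdp_of_locus_of_someFramesAtField hGZ hKo hB hSk hWu hGZK hnf hHL hMaz hPT hEP hK hodd hpd hμ hHN
    hLt hD (P2.bdpValueSomeFrameOnTreeAtField_of_thm32_of_semistable h32 hss) hX hp5 hram htam

/-- **A1 ∩ semistable — `BSD(E,p)` from published + cited facts and (2.4)∃♭ OVER THE PRESCRIBED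
FIELDS.** For ANY finite set `S` of primes and bound `B` chosen by a source: if (2.4)∃♭ holds over
every imaginary quadratic `K` with `d_K ≡ 1 (mod 8)`, `|d_K| > B`, the primes of `S` (and of `N_E p`)
split in `K` and `L(E^{d_K},1) ≠ 0`, then `BSD(E,p)` at every semistable Locus pair (Hoffstein–Luo
supplies the field). CONDITIONAL on (2.4)∃♭ over those fields; nothing booked.
[cite: HoffsteinLuo1997, Theorem] [cite: Castella2018Erratum, (2.4), Thm. 1.1 (pp. 1, 4)]
[cite: Castella2018, Thms. 3.1–3.2, §5] [cite: Skinner2016PacificMC, Thm. C (§1)] -/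
theorem P2.bsdp_of_semistable_locus_of_imcDivSomeFrame_prescribedFields
    (hGZ : ∀ (N : ℕ) [NeZero N] (W : WeierstrassCurve ℚ) (K : Type) [Field K] [NumberField K],
      gross_zagier N W K)
    (hKo : ∀ (N : ℕ) [NeZero N] (W : WeierstrassCurve ℚ) (K : Type) [Field K] [NumberField K],
      kolyvagin N W K)
    (hB : ∀ (N : ℕ) [NeZero N] (W : WeierstrassCurve ℚ) (K : Type) [Field K] [NumberField K],
      Kolyvagin1990_padicValNat_card_sha_le N W K)
    (hSk : Skinner2016.thmC_padicValRat_bsd_rank_zero) (hWu : sha_dvd_analyticSha)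
    (hGZK : rank_eq_analyticRank_of_analyticRank_le_one) (hnf : exists_isNewformOf)
    (hHL : HoffsteinLuo1997_exists_twist_L_one_ne_zero) (hMaz : mazur_not_dvd_maninConstant_of_odd)
    (hPT : ∀ (K : Type) [Field K] [NumberField K], poitouTate_sum_localTatePairing_eq_zero K)
    (hEP : ∀ (K : Type) [Field K] [NumberField K] (v : HeightOneSpectrum (𝓞 K)),
      localEulerPoincareCharacteristic (v.adicCompletion K))
    (h32 : thm32_exists_isBDPLFunction_valueAtOne) (hss : Semistable W)
    -- the source's hypotheses on the field
    (S : Finset ℕ) (hS : ∀ q ∈ S, q.Prime) (B : ℕ)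
    -- THE open statement, over the prescribed fields only
    (hD : ∀ (K : Type) [Field K] [NumberField K], IsImaginaryQuadratic K →
      NumberField.discr K % 8 = 1 → B < (NumberField.discr K).natAbs →
      (∀ q ∈ S, SatisfiesHeegnerHypothesis q K) →
      (W.quadraticTwist (NumberField.discr K : ℚ)).entireLFunction 1 ≠ 0 →
      P2.IMCDivSomeFrameOnTreeAtField W p K)
    -- the pair: on the Locus
    (hX : ClassX11b W p) (hp5 : 5 ≤ p) (hram : Ram W p) (htam : ¬ p ∣ W.tamagawaProduct) :
    BSDp W p :=
  P2.bsdp_of_locus_of_openInputAt_prescribedFields W p hGZ hKo hB hSk hWu hGZK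
    (hasEntireLFunction_rat_of_exists_isNewformOf hnf) hnf hHL hMaz hPT hEP S hS B
    (fun K _ _ hK hd8 hBK hHS hLt ↦ P2.openInputOnTreeAtField_of_someFrames hnf hGZK hKo hPT hEP
      (hD K hK hd8 hBK hHS hLt) (P2.bdpValueSomeFrameOnTreeAtField_of_thm32_of_semistable h32 hss))
    hX hp5 hram htam

end PrintCurrency

end Summit.BirchSwinnertonDyer.Rank1Residual.X11b

end
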